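/-
Copyright (c) 2026. All rights reserved.
Released under Apache 2.0 license as described in the file LICENSE.
Authors: abc-iut cell — seat abc-iut-w4-d104 (gen 2): proof-only BRIDGE between the germ MODEL of
[AbsTopIII] Prop 2.6 (`HolomorphicCoresLocalLinearProofs`, this seat's gen 0) and the abstract
orthogonal frames of Rmk 2.5.1 (over abc-iut-L6-t15's `ParallelogramsPlanar*` chain).
-/
import Literature.AnabelianGeometry.AbsoluteAnabelian.HolomorphicCoresOrientationBridge
import HarnessLib

/-!
# [AbsTopIII] Rmk 2.5.1 / Prop 2.6 (a): orthogonal frames are orthogonal corners, and the germ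
# model's "preserves the orthogonal frames" IS preservation of the abstract orthogonal frames

S. Mochizuki, *Topics in absolute anabelian geometry III* (bib key `MochizukiAbsTopIII2015`), Rmk 2.5.1
(kurims p.57): "a frame at `p` is orthogonal if it arises from an ordered pair of distinct intersecting
sides of a rectangle `∈ ℛ(U) ⊆ 𝒫(U)`"; Prop 2.6 (a) (p.57): "`𝒜_p` … preserve the orthogonal frames and
orientations [at `p`]".

This PROOF-ONLY file (no definitions) closes the `TODO(bridge)` of the germ model
`HolomorphicCoresLocalLinearProofs.lean` (abc-iut-w4-d104 gen 0, p412533) for the ORTHOGONAL-FRAME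
condition: there `LocGerm.PreservesOrthFrames F` is typed CONCRETELY ("`F` is an affine germ whose linear
part maps orthogonal pairs of vectors to orthogonal pairs"), whereas print refers to the ABSTRACT notion
`Parallelograms.IsOrthogonalFrame 𝒬 ℛ p F` of `HolomorphicCores.lean` (abc-iut-L4-t14), relative to the
collection `ℛ` of rectangles.  `HolomorphicCores.lean` defines `𝒫(U)` (`parallelogramsIn`) and `𝒮(U)`
(`squaresIn`) but not `ℛ(U)`; to stay proof-only we take `ℛ` as a PARAMETER together with the
hypothesis `hℛ` saying that `ℛ` is exactly the pre-compact rectangles of `U`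
(`val '' R = openParallelogram z v w`, `v, w` independent and ORTHOGONAL, `closure (val '' R) ⊆ U` — the
shape of `squaresIn`/`parallelogramsIn`) — a `rectanglesIn` definition then instantiates it by `Iff.rfl`.  For an open `U ⊆ ℂ`, `𝒮(U) ⊆ 𝒬 ⊆ 𝒫(U)`, `p ∈ U`:

* `Parallelograms.IsFrameOf.exists_signed_vectors` (adapted from L6-t15's `IsFrameOf.exists_vectors`):
  relative to ANY presentation `val '' P = openParallelogram z v w`, the corner vectors of a frame of `P` at
  `p` are `(±v, ±w)` or `(±w, ±v)`;
* `Parallelograms.isOrthogonalFrame_iff`: a frame at `p` is orthogonal (Rmk 2.5.1) IFF its corner vectors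
  `(e₁, e₂)` are orthogonal, `⟪e₁, e₂⟫_ℝ = 0`;
* `LocGerm.preservesOrthFrames_iff_orthogonalFrames` — **the bridge**: for an affine germ `linGerm p L`
  with `det L ≠ 0`, the model's `PreservesOrthFrames` holds IFF the canonical representative
  `z ↦ p + L (z − p)` maps every orthogonal frame at `p` (whose image lies in `U`) to an orthogonal frame;
  hence every element of `𝒜_p = germAut p` preserves the abstract orthogonal frames
  (`germAut_preserves_orthogonalFrames`).

Refereed pre-IUT material ([AbsTopIII] §2); nothing here bears on the disputed [IUTchIII] Cor. 3.12;
typed ≠ endorsed.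
-/

namespace Literature.AnabelianGeometry.AbsoluteAnabelian

open _root_.Complex _root_.Set _root_.Topology _root_.Filter _root_.Metric
open scoped InnerProductSpace

noncomputable section

/-! ### Frames of a presented parallelogram: the corner vectors are signed edge vectors -/

/-- **Prop 2.5 (d)**, frames relative to a GIVEN presentation (adapted from abc-iut-L6-t15's
`Parallelograms.IsFrameOf.exists_vectors`, which chooses its own presentation): for `𝒮(U) ⊆ 𝒬 ⊆ 𝒫(U)` and
a frame `(P, (S₁, S₂))` at `p` with `val '' P = openParallelogram z v w`, the frame is the corner of `P` at
`p` with corner vectors `(e₁, e₂) = (σ v, τ w)` or `(τ w, σ v)`, `σ, τ ∈ {±1}`: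
`openParallelogram p e₁ e₂ = openParallelogram z v w`, `val '' S₁ = [p, p + e₁]`, `val '' S₂ = [p, p + e₂]`.
[cite: MochizukiAbsTopIII2015, Proposition 2.5 (d) p.56] -/
theorem Parallelograms.IsFrameOf.exists_signed_vectors {U : Set ℂ} (hU : IsOpen U) {𝒬 : Set (Set U)}
    (h𝒬 : ∀ Q ∈ 𝒬, Subtype.val '' Q ∈ parallelogramsIn U)
    (h𝒮 : ∀ Q : Set U, Subtype.val '' Q ∈ squaresIn U → Q ∈ 𝒬) {p : U} {P : Set U} {F : Set U × Set U}
    (hF : Parallelograms.IsFrameOf 𝒬 p P F) {z v w : ℂ} (hvw : LinearIndependent ℝ ![v, w])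
    (hPe : Subtype.val '' P = openParallelogram z v w) (hcl : closure (openParallelogram z v w) ⊆ U) :
    ∃ e₁ e₂ : ℂ, LinearIndependent ℝ ![e₁, e₂] ∧
      openParallelogram (p : ℂ) e₁ e₂ = openParallelogram z v w ∧
      Subtype.val '' F.1 = segment ℝ (p : ℂ) (p + e₁) ∧ Subtype.val '' F.2 = segment ℝ (p : ℂ) (p + e₂) ∧
      ∃ σ τ : ℝ, (σ = 1 ∨ σ = -1) ∧ (τ = 1 ∨ τ = -1) ∧
        ((e₁ = (σ : ℂ) * v ∧ e₂ = (τ : ℂ) * w) ∨ (e₁ = (τ : ℂ) * w ∧ e₂ = (σ : ℂ) * v)) := by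
  obtain ⟨hP, hS₁, hS₂, hne, hint⟩ := hF
  rw [Parallelograms.parallelograms_eq_of_subset hU h𝒬 h𝒮] at hP hS₁ hS₂
  obtain ⟨A, hA⟩ := exists_homeomorph_frame z v w hvw
  have h𝒬' : ∀ Q ∈ {P : Set U | Subtype.val '' P ∈ parallelogramsIn U},
      Subtype.val '' Q ∈ parallelogramsIn U := fun _ h => h
  have h𝒮' : ∀ Q : Set U, Subtype.val '' Q ∈ squaresIn U →
      Q ∈ {P : Set U | Subtype.val '' P ∈ parallelogramsIn U} :=
    fun _ h => squaresIn_subset_parallelogramsIn U h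
  obtain ⟨E₁, hE₁, hF₁⟩ := (Parallelograms.isSide_iff_of_subset hU h𝒬' h𝒮' hP hPe hvw hcl hA).1 hS₁
  obtain ⟨E₂, hE₂, hF₂⟩ := (Parallelograms.isSide_iff_of_subset hU h𝒬' h𝒮' hP hPe hvw hcl hA).1 hS₂
  have hFF : F.1 ∩ F.2 = Subtype.val ⁻¹' (A '' (E₁ ∩ E₂)) := by
    rw [hF₁, hF₂, ← preimage_inter, ← image_inter A.injective]
  have hEU : ∀ {E : Set ℂ}, (E = Icc 0 1 ×ℂ {(0 : ℝ)} ∨ E = Icc 0 1 ×ℂ {(1 : ℝ)} ∨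
      E = {(0 : ℝ)} ×ℂ Icc 0 1 ∨ E = {(1 : ℝ)} ×ℂ Icc 0 1) → A '' E ⊆ U := fun hE =>
    (image_mono (sq_edge_subset_boundary hE)).trans
      ((closure_diff_openParallelogram_eq_image hvw hA).symm.le.trans (sdiff_subset.trans hcl))
  have hvalF₁ : Subtype.val '' F.1 = A '' E₁ := by
    rw [hF₁, image_preimage_eq_inter_range, Subtype.range_coe, inter_eq_left]; exact hEU hE₁
  have hvalF₂ : Subtype.val '' F.2 = A '' E₂ := by
    rw [hF₂, image_preimage_eq_inter_range, Subtype.range_coe, inter_eq_left]; exact hEU hE₂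
  rcases sq_edges_cases hE₁ hE₂ with heq | hdis | ⟨s₀, t₀, hs, ht, hor⟩
  · exact absurd (by rw [hF₁, hF₂, heq]) hne
  · exfalso
    have hp : p ∈ F.1 ∩ F.2 := by rw [hint]; exact mem_singleton p
    rw [hFF, hdis, image_empty] at hp
    exact hp
  · have hcorner : E₁ ∩ E₂ = {(⟨s₀, t₀⟩ : ℂ)} := by
      rcases hor with ⟨rfl, rfl⟩ | ⟨rfl, rfl⟩
      · exact sq_edges_inter_eq_corner hs ht
      · rw [inter_comm]; exact sq_edges_inter_eq_corner hs ht
    have hpA : (p : ℂ) = z + (s₀ : ℂ) * v + (t₀ : ℂ) * w := by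
      have hp : p ∈ F.1 ∩ F.2 := by rw [hint]; exact mem_singleton p
      rw [hFF, hcorner, image_singleton] at hp
      have : (p : ℂ) = A ⟨s₀, t₀⟩ := hp
      rw [this, hA]
    have hs' : (1 - 2 * s₀ : ℝ) ≠ 0 := by rcases hs with rfl | rfl <;> norm_num
    have ht' : (1 - 2 * t₀ : ℝ) ≠ 0 := by rcases ht with rfl | rfl <;> norm_num
    have hσ : (1 - 2 * s₀ : ℝ) = 1 ∨ (1 - 2 * s₀ : ℝ) = -1 := by
      rcases hs with rfl | rfl
      · left; norm_num
      · right; norm_num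
    have hτ : (1 - 2 * t₀ : ℝ) = 1 ∨ (1 - 2 * t₀ : ℝ) = -1 := by
      rcases ht with rfl | rfl
      · left; norm_num
      · right; norm_num
    have hPc := (openParallelogram_corner (z := z) (v := v) (w := w) hs ht)
    have hH := image_frame_horizontal_corner hA (t₀ := t₀) hs
    have hV := image_frame_vertical_corner hA (s₀ := s₀) ht
    rw [← hpA] at hPc hH hV
    rcases hor with ⟨rfl, rfl⟩ | ⟨rfl, rfl⟩
    · refine ⟨_, _, linearIndependent_pair_smul hvw hs' ht', hPc, hvalF₁.trans hH, hvalF₂.trans hV,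
        (1 - 2 * s₀), (1 - 2 * t₀), hσ, hτ, Or.inl ⟨rfl, rfl⟩⟩
    · refine ⟨_, _, linearIndependent_pair_smul (LinearIndependent.pair_symm_iff.mp hvw) ht' hs',
        (openParallelogram_comm _ _ _).trans hPc, hvalF₁.trans hV, hvalF₂.trans hH,
        (1 - 2 * s₀), (1 - 2 * t₀), hσ, hτ, Or.inr ⟨rfl, rfl⟩⟩

/-- Orthogonal non-zero vectors are `ℝ`-independent. (Auxiliary.)
[cite: MochizukiAbsTopIII2015, Remark 2.5.1 p.57] -/
theorem linearIndependent_pair_of_inner_eq_zero {u v : ℂ} (hu : u ≠ 0) (hv : v ≠ 0)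
    (huv : ⟪u, v⟫_ℝ = 0) : LinearIndependent ℝ ![u, v] := by
  rw [linearIndependent_pair_iff_det]
  -- the real inner product in coordinates (`Literature.Analysis.Pluripotential.real_inner_complex_eq`,
  -- re-derived locally to keep the import light)
  replace huv : u.re * v.re + u.im * v.im = 0 := by
    rw [Complex.inner, Complex.mul_re, Complex.conj_re, Complex.conj_im] at huv
    linear_combination huv
  intro hdet
  -- Lagrange: det² + ⟪u,v⟫² = |u|² |v|²
  have hL : (u.re * v.im - u.im * v.re) ^ 2 + (u.re * v.re + u.im * v.im) ^ 2 =
      (u.re ^ 2 + u.im ^ 2) * (v.re ^ 2 + v.im ^ 2) := by ring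
  rw [hdet, huv] at hL
  have hu' : 0 < u.re ^ 2 + u.im ^ 2 := by
    rcases (Complex.ext_iff.not.1 hu : ¬ (u.re = (0:ℂ).re ∧ u.im = (0:ℂ).im)) |> not_and_or.1 with h | h
    · have : u.re ≠ 0 := by simpa using h
      positivity
    · have : u.im ≠ 0 := by simpa using h
      positivity
  have hv' : 0 < v.re ^ 2 + v.im ^ 2 := by
    rcases (Complex.ext_iff.not.1 hv : ¬ (v.re = (0:ℂ).re ∧ v.im = (0:ℂ).im)) |> not_and_or.1 with h | h
    · have : v.re ≠ 0 := by simpa using h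
      positivity
    · have : v.im ≠ 0 := by simpa using h
      positivity
  nlinarith [mul_pos hu' hv']

/-- Signed orthogonal vectors stay orthogonal, in either order. (Auxiliary.)
[cite: MochizukiAbsTopIII2015, Remark 2.5.1 p.57] -/
theorem inner_signed_eq_zero {v w : ℂ} (hvw : ⟪v, w⟫_ℝ = 0) {σ τ : ℝ} {e₁ e₂ : ℂ}
    (h : (e₁ = (σ : ℂ) * v ∧ e₂ = (τ : ℂ) * w) ∨ (e₁ = (τ : ℂ) * w ∧ e₂ = (σ : ℂ) * v)) :
    ⟪e₁, e₂⟫_ℝ = 0 := by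
  have coords : ∀ x y : ℂ, ⟪x, y⟫_ℝ = x.re * y.re + x.im * y.im := fun x y => by
    rw [Complex.inner, Complex.mul_re, Complex.conj_re, Complex.conj_im]; ring
  rw [coords] at hvw ⊢
  rcases h with ⟨rfl, rfl⟩ | ⟨rfl, rfl⟩
  · simp only [Complex.mul_re, Complex.mul_im, Complex.ofReal_re, Complex.ofReal_im, zero_mul,
      sub_zero, add_zero]
    linear_combination σ * τ * hvw
  · simp only [Complex.mul_re, Complex.mul_im, Complex.ofReal_re, Complex.ofReal_im, zero_mul,
      sub_zero, add_zero]
    linear_combination τ * σ * hvw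

/-! ### Rmk 2.5.1: orthogonal frames are exactly the frames with orthogonal corner vectors -/

section Orthogonal

variable {U : Set ℂ} (hU : IsOpen U) {𝒬 : Set (Set U)}
  (h𝒬 : ∀ Q ∈ 𝒬, Subtype.val '' Q ∈ parallelogramsIn U)
  (h𝒮 : ∀ Q : Set U, Subtype.val '' Q ∈ squaresIn U → Q ∈ 𝒬)
  {ℛ : Set (Set U)}
  (hℛ : ∀ R : Set U, R ∈ ℛ ↔ ∃ z v w : ℂ, LinearIndependent ℝ ![v, w] ∧ ⟪v, w⟫_ℝ = 0 ∧
    Subtype.val '' R = openParallelogram z v w ∧ closure (Subtype.val '' R) ⊆ U)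

include hU h𝒬 h𝒮 hℛ in
/-- **Rmk 2.5.1 — orthogonal frames are orthogonal corners**: for `𝒮(U) ⊆ 𝒬 ⊆ 𝒫(U)` and `ℛ = ℛ(U)` the
pre-compact rectangles, a pair `F = (S₁, S₂)` is an orthogonal frame at `p` ("arises from an ordered pair
of distinct intersecting sides of a rectangle") IFF `val '' S₁ = [p, p + e₁]`, `val '' S₂ = [p, p + e₂]`
for some `ℝ`-independent ORTHOGONAL `e₁, e₂` with the closed parallelogram at `p` inside `U`.
[cite: MochizukiAbsTopIII2015, Remark 2.5.1 p.57] -/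
theorem Parallelograms.isOrthogonalFrame_iff {p : U} {F : Set U × Set U} :
    Parallelograms.IsOrthogonalFrame 𝒬 ℛ p F ↔
      ∃ e₁ e₂ : ℂ, LinearIndependent ℝ ![e₁, e₂] ∧ ⟪e₁, e₂⟫_ℝ = 0 ∧
        closure (openParallelogram (p : ℂ) e₁ e₂) ⊆ U ∧
        Subtype.val '' F.1 = segment ℝ (p : ℂ) (p + e₁) ∧
        Subtype.val '' F.2 = segment ℝ (p : ℂ) (p + e₂) := by
  constructor
  · rintro ⟨R, hR, hF⟩
    obtain ⟨z, v, w, hvw, hperp, hRe, hcl⟩ := (hℛ R).1 hR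
    rw [hRe] at hcl
    obtain ⟨e₁, e₂, he, hPe, h₁, h₂, σ, τ, -, -, hsign⟩ :=
      Parallelograms.IsFrameOf.exists_signed_vectors hU h𝒬 h𝒮 hF hvw hRe hcl
    exact ⟨e₁, e₂, he, inner_signed_eq_zero hperp hsign, hPe ▸ hcl, h₁, h₂⟩
  · rintro ⟨e₁, e₂, he, hperp, hcl, h₁, h₂⟩
    obtain ⟨hPU, hS₁U, hS₂U⟩ := subsets_of_closure_openParallelogram_subset he hcl
    refine ⟨Subtype.val ⁻¹' openParallelogram (p : ℂ) e₁ e₂, (hℛ _).2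
      ⟨p, e₁, e₂, he, hperp, image_val_preimage_val_of_subset hPU,
        by rw [image_val_preimage_val_of_subset hPU]; exact hcl⟩, ?_⟩
    have hF : F = (Subtype.val ⁻¹' segment ℝ (p : ℂ) (p + e₁),
        Subtype.val ⁻¹' segment ℝ (p : ℂ) (p + e₂)) := by
      refine Prod.ext ?_ ?_
      · exact (eq_preimage_image_val F.1).trans (congrArg (fun S : Set ℂ => (Subtype.val ⁻¹' S : Set U)) h₁)
      · exact (eq_preimage_image_val F.2).trans (congrArg (fun S : Set ℂ => (Subtype.val ⁻¹' S : Set U)) h₂)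
    rw [hF]
    exact Parallelograms.isFrameOf_of_vectors hU h𝒬 h𝒮 he hcl

/-! ### Prop 2.6 (a): the germ model's orthogonal-frame condition against Rmk 2.5.1 -/

/-- The model's concrete condition on an affine germ, unfolded: the (unique) linear part maps orthogonal
pairs to orthogonal pairs. [cite: MochizukiAbsTopIII2015, Proposition 2.6 (a) p.57] -/
theorem LocGerm.preservesOrthFrames_linGerm_iff (p : ℂ) (L : ℂ →L[ℝ] ℂ) :
    (LocGerm.linGerm p L).PreservesOrthFrames ↔ ∀ u v : ℂ, ⟪u, v⟫_ℝ = 0 → ⟪L u, L v⟫_ℝ = 0 := by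
  constructor
  · rintro ⟨L', hL', h⟩
    obtain rfl := LocGerm.linGerm_injective p hL'
    exact h
  · exact fun h => ⟨L, rfl, h⟩

include hU in
/-- Given directions `u, v` there is a scale `t > 0` such that the parallelograms at `p` with edges
`(t u, t v)` and `(L (t u), L (t v))` both have closure in `U`. (Auxiliary.)
[cite: MochizukiAbsTopIII2015, Proposition 2.6 (a) p.57] -/
theorem exists_scale_closure_subset (p : U) (L : ℂ →L[ℝ] ℂ) (u v : ℂ) :
    ∃ t : ℝ, 0 < t ∧ closure (openParallelogram (p : ℂ) ((t : ℂ) * u) ((t : ℂ) * v)) ⊆ U ∧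
      closure (openParallelogram (p : ℂ) (L ((t : ℂ) * u)) (L ((t : ℂ) * v))) ⊆ U := by
  obtain ⟨r, hr, hball⟩ := Metric.isOpen_iff.1 hU p p.2
  set M : ℝ := ‖u‖ + ‖v‖ + ‖L u‖ + ‖L v‖ + 1 with hM
  have hMpos : 0 < M := by positivity
  refine ⟨r / (2 * M), by positivity, ?_, ?_⟩
  · refine (closure_openParallelogram_subset_closedBall _ _ _).trans
      ((Metric.closedBall_subset_ball ?_).trans hball)
    rw [norm_mul, norm_mul, Complex.norm_real, Real.norm_of_nonneg (by positivity)]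
    have : r / (2 * M) * ‖u‖ + r / (2 * M) * ‖v‖ = r / (2 * M) * (‖u‖ + ‖v‖) := by ring
    rw [this]
    calc r / (2 * M) * (‖u‖ + ‖v‖) ≤ r / (2 * M) * M := by gcongr; rw [hM]; linarith [norm_nonneg (L u), norm_nonneg (L v)]
      _ = r / 2 := by field_simp
      _ < r := by linarith
  · refine (closure_openParallelogram_subset_closedBall _ _ _).trans
      ((Metric.closedBall_subset_ball ?_).trans hball)
    rw [← Complex.real_smul, ← Complex.real_smul, map_smul, map_smul, norm_smul, norm_smul,
      Real.norm_of_nonneg (by positivity)]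
    have : r / (2 * M) * ‖L u‖ + r / (2 * M) * ‖L v‖ = r / (2 * M) * (‖L u‖ + ‖L v‖) := by ring
    rw [this]
    calc r / (2 * M) * (‖L u‖ + ‖L v‖) ≤ r / (2 * M) * M := by gcongr; rw [hM]; linarith [norm_nonneg u, norm_nonneg v]
      _ = r / 2 := by field_simp
      _ < r := by linarith

include hU h𝒬 h𝒮 hℛ in
/-- **The bridge ([AbsTopIII] Prop 2.6 (a), "preserve the orthogonal frames … [at `p`]", Rmk 2.5.1)**:
for `p ∈ U`, `𝒮(U) ⊆ 𝒬 ⊆ 𝒫(U)`, `ℛ = ℛ(U)` the rectangles, and an affine germ `linGerm p L` mapping frames to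
frames (`det L ≠ 0`), the germ MODEL's concrete condition `PreservesOrthFrames` holds IFF every orthogonal
frame `F` at `p` with corner vectors `(e₁, e₂)` whose image frame `F'` (corner vectors `(L e₁, L e₂)`:
the image under the canonical representative `z ↦ p + L (z − p)`) lies in `U` has `F'` ORTHOGONAL.
[cite: MochizukiAbsTopIII2015, Proposition 2.6 (a) p.57] -/
theorem LocGerm.preservesOrthFrames_iff_orthogonalFrames (p : U) {L : ℂ →L[ℝ] ℂ}
    (hL : LinearMap.det (L : ℂ →ₗ[ℝ] ℂ) ≠ 0) :
    (LocGerm.linGerm (p : ℂ) L).PreservesOrthFrames ↔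
      ∀ (F F' : Set U × Set U) (e₁ e₂ : ℂ), Parallelograms.IsOrthogonalFrame 𝒬 ℛ p F →
        Subtype.val '' F.1 = segment ℝ (p : ℂ) (p + e₁) →
        Subtype.val '' F.2 = segment ℝ (p : ℂ) (p + e₂) →
        Subtype.val '' F'.1 = segment ℝ (p : ℂ) (p + L e₁) →
        Subtype.val '' F'.2 = segment ℝ (p : ℂ) (p + L e₂) →
        closure (openParallelogram (p : ℂ) (L e₁) (L e₂)) ⊆ U →
        Parallelograms.IsOrthogonalFrame 𝒬 ℛ p F' := by
  rw [LocGerm.preservesOrthFrames_linGerm_iff]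
  constructor
  · intro hpres F F' e₁ e₂ hF h₁ h₂ h₁' h₂' hcl'
    obtain ⟨f₁, f₂, hf, hperp, -, hf₁, hf₂⟩ :=
      (Parallelograms.isOrthogonalFrame_iff hU h𝒬 h𝒮 hℛ).1 hF
    obtain ⟨rfl, rfl⟩ := Parallelograms.frame_vectors_unique hf hf₁ hf₂ h₁ h₂
    exact (Parallelograms.isOrthogonalFrame_iff hU h𝒬 h𝒮 hℛ).2
      ⟨_, _, linearIndependent_pair_apply hL hf, hpres _ _ hperp, hcl', h₁', h₂'⟩
  · intro hall u v huv
    by_cases hu : u = 0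
    · simp [hu]
    by_cases hv : v = 0
    · simp [hv]
    have hli := linearIndependent_pair_of_inner_eq_zero hu hv huv
    obtain ⟨t, ht, hcl, hcl'⟩ := exists_scale_closure_subset hU p L u v
    have htC : (t : ℂ) ≠ 0 := by exact_mod_cast ht.ne'
    have hlit : LinearIndependent ℝ ![(t : ℂ) * u, (t : ℂ) * v] := linearIndependent_pair_smul hli ht.ne' ht.ne'
    have hperpt : ⟪(t : ℂ) * u, (t : ℂ) * v⟫_ℝ = 0 := by
      rw [inner_mul_left_mul_left, huv, mul_zero]
    have hLt := linearIndependent_pair_apply hL hlit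
    obtain ⟨hPU, hS₁U, hS₂U⟩ := subsets_of_closure_openParallelogram_subset hlit hcl
    obtain ⟨hPU', hS₁U', hS₂U'⟩ := subsets_of_closure_openParallelogram_subset hLt hcl'
    have hF : Parallelograms.IsOrthogonalFrame 𝒬 ℛ p
        (Subtype.val ⁻¹' segment ℝ (p : ℂ) (p + (t : ℂ) * u),
          Subtype.val ⁻¹' segment ℝ (p : ℂ) (p + (t : ℂ) * v)) :=
      (Parallelograms.isOrthogonalFrame_iff hU h𝒬 h𝒮 hℛ).2 ⟨_, _, hlit, hperpt, hcl,
        image_val_preimage_val_of_subset hS₁U, image_val_preimage_val_of_subset hS₂U⟩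
    have hF' := hall _ (Subtype.val ⁻¹' segment ℝ (p : ℂ) (p + L ((t : ℂ) * u)),
        Subtype.val ⁻¹' segment ℝ (p : ℂ) (p + L ((t : ℂ) * v))) _ _ hF
      (image_val_preimage_val_of_subset hS₁U) (image_val_preimage_val_of_subset hS₂U)
      (image_val_preimage_val_of_subset hS₁U') (image_val_preimage_val_of_subset hS₂U') hcl'
    obtain ⟨g₁, g₂, hg, hgperp, -, hg₁, hg₂⟩ := (Parallelograms.isOrthogonalFrame_iff hU h𝒬 h𝒮 hℛ).1 hF'
    obtain ⟨hg₁', hg₂'⟩ := Parallelograms.frame_vectors_unique hg hg₁ hg₂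
      (image_val_preimage_val_of_subset hS₁U') (image_val_preimage_val_of_subset hS₂U')
    -- `L (t u) = g₁`, `L (t v) = g₂` are orthogonal; unscale
    rw [← hg₁', ← hg₂', ← Complex.real_smul, ← Complex.real_smul, map_smul, map_smul, Complex.real_smul,
      Complex.real_smul, inner_mul_left_mul_left] at hgperp
    rcases mul_eq_zero.1 hgperp with h | h
    · exact absurd (Complex.normSq_eq_zero.1 h) htC
    · exact h

include hU h𝒬 h𝒮 hℛ in
/-- **Prop 2.6 (a): every element of `𝒜_p = germAut p` preserves the abstract orthogonal frames at `p`**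
(Rmk 2.5.1): it is an affine germ `linGerm p L`, `det L ≠ 0`, whose canonical representative maps each
orthogonal frame at `p` (with image in `U`) to an orthogonal frame.
[cite: MochizukiAbsTopIII2015, Proposition 2.6 (a) p.57] -/
theorem germAut_preserves_orthogonalFrames (p : U) (u : (LocGerm (p : ℂ))ˣ) (hu : u ∈ germAut (p : ℂ)) :
    ∃ L : ℂ →L[ℝ] ℂ, (u : LocGerm (p : ℂ)) = LocGerm.linGerm (p : ℂ) L ∧
      LinearMap.det (L : ℂ →ₗ[ℝ] ℂ) ≠ 0 ∧
      ∀ (F F' : Set U × Set U) (e₁ e₂ : ℂ), Parallelograms.IsOrthogonalFrame 𝒬 ℛ p F →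
        Subtype.val '' F.1 = segment ℝ (p : ℂ) (p + e₁) →
        Subtype.val '' F.2 = segment ℝ (p : ℂ) (p + e₂) →
        Subtype.val '' F'.1 = segment ℝ (p : ℂ) (p + L e₁) →
        Subtype.val '' F'.2 = segment ℝ (p : ℂ) (p + L e₂) →
        closure (openParallelogram (p : ℂ) (L e₁) (L e₂)) ⊆ U →
        Parallelograms.IsOrthogonalFrame 𝒬 ℛ p F' := by
  obtain ⟨-, ⟨L, hL, horth⟩, hor⟩ := (mem_germAut u).1 hu
  obtain ⟨L', hL', hdet⟩ := hor
  have hLL : L' = L := LocGerm.linGerm_injective (p : ℂ) (hL'.symm.trans hL)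
  subst hLL
  refine ⟨L', hL', hdet.ne', ?_⟩
  exact (LocGerm.preservesOrthFrames_iff_orthogonalFrames hU h𝒬 h𝒮 hℛ p hdet.ne').1 ⟨L', rfl, horth⟩

include hU h𝒬 h𝒮 hℛ in
/-- **[AbsTopIII] Prop 2.6 (a) — `𝒜_p` in print's terms.**  For `p ∈ U`, `𝒮(U) ⊆ 𝒬 ⊆ 𝒫(U)` and `ℛ = ℛ(U)`:
a unit `u` of the germ monoid at `p` (an automorphism of the projective system of neighbourhoods of `p`)
lies in the MODEL's `germAut p` IFF it is compatible with the local additive structure (an affine germ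
`z ↦ p + L (z − p)`, `LocGerm.isAddCompat_iff`) mapping frames to frames (`det L ≠ 0`) whose canonical
representative maps ORTHOGONAL FRAMES (Rmk 2.5.1) to orthogonal frames and every frame into ITS OWN class
of the abstract ORIENTATIONS `Parallelograms.Orientations 𝒬 p` (Prop 2.5 (d)) — the three printed
conditions, now all read against the abstract notions of `HolomorphicCores.lean`.
[cite: MochizukiAbsTopIII2015, Proposition 2.6 (a) p.57] -/
theorem mem_germAut_iff_abstract (p : U) (u : (LocGerm (p : ℂ))ˣ) :
    u ∈ germAut (p : ℂ) ↔ ∃ L : ℂ →L[ℝ] ℂ, (u : LocGerm (p : ℂ)) = LocGerm.linGerm (p : ℂ) L ∧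
      LinearMap.det (L : ℂ →ₗ[ℝ] ℂ) ≠ 0 ∧
      (∀ (F F' : Set U × Set U) (e₁ e₂ : ℂ), Parallelograms.IsOrthogonalFrame 𝒬 ℛ p F →
        Subtype.val '' F.1 = segment ℝ (p : ℂ) (p + e₁) →
        Subtype.val '' F.2 = segment ℝ (p : ℂ) (p + e₂) →
        Subtype.val '' F'.1 = segment ℝ (p : ℂ) (p + L e₁) →
        Subtype.val '' F'.2 = segment ℝ (p : ℂ) (p + L e₂) →
        closure (openParallelogram (p : ℂ) (L e₁) (L e₂)) ⊆ U →
        Parallelograms.IsOrthogonalFrame 𝒬 ℛ p F') ∧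
      (∀ (F F' : {PF : Set U × (Set U × Set U) // Parallelograms.IsFrameOf 𝒬 p PF.1 PF.2})
        (e₁ e₂ : ℂ), LinearIndependent ℝ ![e₁, e₂] →
        Subtype.val '' F.1.1 = openParallelogram (p : ℂ) e₁ e₂ →
        Subtype.val '' F.1.2.1 = segment ℝ (p : ℂ) (p + e₁) →
        Subtype.val '' F.1.2.2 = segment ℝ (p : ℂ) (p + e₂) →
        Subtype.val '' F'.1.1 = openParallelogram (p : ℂ) (L e₁) (L e₂) →
        Subtype.val '' F'.1.2.1 = segment ℝ (p : ℂ) (p + L e₁) →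
        Subtype.val '' F'.1.2.2 = segment ℝ (p : ℂ) (p + L e₂) →
        (Quot.mk _ F : Parallelograms.Orientations 𝒬 p) = Quot.mk _ F') := by
  constructor
  · intro hu
    obtain ⟨-, ⟨L, hL, horth⟩, ⟨L', hL', hdet⟩⟩ := (mem_germAut u).1 hu
    have hLL : L' = L := LocGerm.linGerm_injective (p : ℂ) (hL'.symm.trans hL)
    subst hLL
    refine ⟨L', hL', hdet.ne', ?_, ?_⟩
    · exact (LocGerm.preservesOrthFrames_iff_orthogonalFrames hU h𝒬 h𝒮 hℛ p hdet.ne').1 ⟨L', rfl, horth⟩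
    · exact ((LocGerm.preservesOrientation_iff_orientations hU h𝒬 h𝒮 p L').1 ⟨L', rfl, hdet⟩).2
  · rintro ⟨L, hL, hdet, horth, hor⟩
    rw [mem_germAut, hL]
    exact ⟨LocGerm.isAddCompat_linGerm L,
      (LocGerm.preservesOrthFrames_iff_orthogonalFrames hU h𝒬 h𝒮 hℛ p hdet).2 horth,
      (LocGerm.preservesOrientation_iff_orientations hU h𝒬 h𝒮 p L).2 ⟨hdet, hor⟩⟩

end Orthogonal

end

end Literature.AnabelianGeometry.AbsoluteAnabelian
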